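import Mathlib.Algebra.BigOperators.Fin
import Mathlib.Algebra.BigOperators.Pi
import Mathlib.Data.ZMod.Basic
import Mathlib.Data.Matrix.Mul
import Mathlib.GroupTheory.SpecificGroups.Dihedral
import Mathlib.LinearAlgebra.Dimension.Constructions
import Mathlib.Tactic.FinCases
import Mathlib.Tactic.Ring

/-!
# Dodecic atlas, type `D₆`: the Galois closures of the generic sextic CM fields `K = k·F₀` — the Hodge lattice of the whole `F`-slice, its six Weil orbits and four atoms (kernel census)

COR-CM (cell `pub-hodgecm2`), count-neutral kernel census by the binder seat b17 (gen 39; claim D6-KERNEL, fourth and last row of the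
order-12 table after `Census/DodecicDicyclicSpecies.lean` (`Dic₃`), `Census/DodecicCyclicSpecies.lean` (`ℤ/12`),
`Census/DodecicC6C2Species.lean` (`ℤ/6 × ℤ/2`)): the kernel certificate of the `D₆` row of the cell memos
`HOME/pub-hodgecm2-lit-andre-3/PORTFOLIO-lit-andre-3-g8.md` (μ(D₆) = 4 "mod hW4", exact) and `HOME/pub-hodgecm2-b17/dic3/ORDER12-CARRIERS.md`
(b17 gen 38: minimal carrier profile `(12,12,12,12)`).  The type with the most structure: ten simple factors (two CM elliptic curves,
SIX CM threefolds, two CM sixfolds), NON-NORMAL stabilisers (the threefold labels are coset SETS `G/⟨reflection⟩`, handled by the affine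
action `labT`/`act`), a "Markman" sublattice of SIX Weil orbits (the fourfolds `E × T`), and a minimality `μ = 4` that no abelian
invariant sees (block parities give `2`): it is the multiplicity `8` of the STANDARD representation of `S₃ = D₆/⟨c⟩` in `(H/(P+Mk)) ⊗ ℚ`,
certified over `𝔽₂` in the sequel `Census/DodecicDihedralMinimality.lean`; the lattice theorem is `Census/DodecicDihedralLattice.lean`.
No named fact, no geometry, no `sorry`: `decide`, `simp`, `omega` only in this file.  HC_CM is not proved anywhere in this cell;
nothing here is a headline.  Neighbour by name (not imported): lit-andre-3's `Census/DihedralSextic*.lean` (the sub-slice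
`B₀ × B₁ × B₂ × E` of three threefolds and one curve of this very type, species basis of rank `15`) and b30's
`Census/DihedralSexticFace.lean`; the present files treat the WHOLE slice (all ten factors, rank `58`).

DICTIONARY (cited, not formalised; as in `Census/OcticQuaternionSpecies.lean`): `F` Galois CM, `G = Gal(F/ℚ) = Hom(F, ℚ̄)`, `c ∈ Z(G)`;
CM types `T ⊔ cT = G`; simple CM abelian varieties split by `F` ↔ orbits of CM types under RIGHT translation, right stabiliser
`H_T` ↔ CM field `F^{H_T}`, `dim = |G|/2|H_T|`, eigen-labels = left cosets `G/H_T` = `Hom(F^{H_T}, ℚ̄)`, LEFT translation = Galois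
conjugation [cite: Milne1999, Prop. 2.1 and the paragraph after it, p. 54]; Hodge monomials ⟺ all Pohlmann forms vanish
[cite: Pohlmann1968, Thm 1]; conjugate pairs = divisor classes.

THIS TYPE.  `G = D₆ = ⟨r, s | r⁶ = s² = 1, srs = r⁻¹⟩` (Mathlib's `DihedralGroup 6`: `r i`, `sr i`), `c = r³` central; `D₆ ≅ S₃ × C₂`.
`F = L·k` is the Galois closure of a sextic CM field `K = k·F₀` with `k` imaginary quadratic and `F₀` a non-Galois totally real cubic
(`L` = Galois closure of `F₀`, group `S₃`); CM subfields: the two imaginary quadratic fields `k₀ = F^{⟨r², s⟩}`, `k₁ = F^{⟨r², rs⟩}`, the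
six sextic CM fields `K_i = F^{⟨s rⁱ⟩}` (`i` even: `K_i ⊃ k₀`, `i` odd: `K_i ⊃ k₁`; each is an imaginary quadratic field times a
conjugate of `F₀`, e.g. `K` itself), and `F`.  `types_census`: `64` CM types
= `2 + 2` (ELLIPTIC CURVES `E₀, E₁`) `+ 6·6` (THREEFOLDS `T₀, …, T₅`, CM by the six non-Galois sextic CM subfields; their right
stabilisers `⟨s rⁱ⟩` are NOT normal) `+ 2·12` (SIXFOLDS `B₀, B₁`, CM by `F`).  Labels (`Pt`, 64): `e j u` (`u ∈ ℤ/2`), `t j u` (`u ∈ ℤ/6`: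
the coset `r^u ⟨s r^{κ_j}⟩`, `κ = (0,1,0,1,0,5)` = `kT`), `q j g` (`g ∈ G`); the Galois action `act` is the quotient map `epsE j` on the
curves, the AFFINE action `r^i : u ↦ u + i`, `s r^i : u ↦ κ_j − i − u` on the threefold labels (`labels_census`: `labT j (g h) =
g · labT j h`), and left multiplication on the sixfold labels.  The slice is the family of all products of powers of the ten factors.
NUMBERS (exact oracle `dic3k/d6model.py` = b17 g38 `dic3/gmodel.py`): Pohlmann forms of rank `6`, `H` of rank `58`, `32` conjugate pairs
(`P`); `36` Hodge monomials on carriers of dimension `≤ 5` outside `P`, spanning with `P` a lattice of rank `38` = `P` + translates of the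
SIX Weil orbits `mkRep` (the fourfolds `E_a × T_j` of Weil type, Künneth `(1,3)`, orbits of size `2`; algebraic by Markman's fourfold
theorem / the cell's `CMWeights.hodgeConjectureFor_of_isOfCMType_dim_le_five_of_markman`, NOT used here); `M = H/(P + Mk)` of rank `20`
`≅ 1² ⊕ sgn² ⊕ std⁸` as a `ℚ[S₃]`-module, generated by FOUR more orbits and no fewer.

KERNEL, THIS FILE.  `types_census`, `labels_census`, `sanity` · `hodgeLattice`, `mem_hodgeLattice` · `pairs` (`P`), `markman` (`Mk`),
`atoms` (`A` = translates of `orbitRep 0, …, 3`) · `atom_census` (Künneth types over the ten blocks `E₀,E₁,T₀,…,T₅,B₀,B₁`; carriers =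
four CM `12`-folds `T₄ × T₅ × B₁`, `T₄ × T₅ × B₀`, `T₂ × T₃ × B₁`, `T₀ × T₁ × B₁` of Künneth types `(1,2,1)/(2,1,1)`, codimension `2` —
the lexicographically minimal profile `(12,12,12,12)`, exhaustive oracle ORDER12-CARRIERS, none on carriers `≤ 11`; orbit sizes) ·
`pairs_le`, `markman_le`, `atoms_le`.  SEQUELS: `…Lattice.lean`: **`hodgeLattice = pairs ⊔ markman ⊔ atoms`**; `…Minimality.lean`:
**every finite `S` with `H ≤ P ⊔ Mk ⊔ Σ_{t∈S} ℤ[G]·t` has `|S| ≥ 4`**.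

THEOREM (informal; complete given (O1)–(O4) of `Census/DihedralFourCoreLattice.lean` and Markman's fourfold theorem for the six Weil
orbits).  Let `K` be a sextic CM field containing an imaginary quadratic field whose totally real cubic subfield is not Galois, `F` its
Galois closure, and `Z` ANY abelian variety isogenous to a product of powers of the ten simple CM abelian varieties split by `F`.  If on
each of the four CM `12`-folds above ONE algebraic class has a non-zero component on the eigen-line of the corresponding atom (four
codimension-`2` statements), then every Hodge class on `Z` is algebraic; three orbits never suffice (sequel).  Open in print as far as
the seat knows.

## References
* [Pohlmann1968] H. Pohlmann, Algebraic cycles on abelian varieties of complex multiplication type, Ann. of Math. 88 (1968), Thm 1.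
* [Milne1999] J. S. Milne, Lefschetz motives and the Tate conjecture, Compositio Math. 117 (1999), Prop. 2.1, p. 54.

## Provenance
Exact oracles (seat folder `work/dic3k/`, copies in `HOME/pub-hodgecm2-b17/dic3k/`): `d6model.py` (model in Mathlib's `DihedralGroup`
convention, cross-check with `dic3/gmodel.py`, family `gexhaust_D6_k4_le12.json[0]`, Weil-orbit representatives), `rowcert2.py`
(certificate), `twist6.py` (the `𝔽₂[S₃]`-invariant), `gen_lean_d6.py` (the three files are generated verbatim from `data_d6model.json`,
`twist_d6model.json`).
-/

namespace Summit.HodgeConjecture.CorCM.Census.DodecicDihedralSpecies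

open Finset DihedralGroup

/-! ## The group `D₆`, its CM types and the simple factors -/

/-- `G = D₆` (Mathlib's `DihedralGroup 6`: `r i`, `sr i`, `i ∈ ℤ/6`); the complex conjugation is `c = r 3`. [folklore] -/
abbrev G := DihedralGroup 6

/-- The CM types of `(G, c)` as subsets `T ⊆ G`: for every `g` exactly one of `g`, `cg` lies in `T`. [folklore] -/
def cmTypes : Finset (Finset G) := univ.powerset.filter fun T => ∀ g : G, g ∈ T ↔ (r 3 : G) * g ∉ T

/-- The CM types of the simple factors: `0, 1` the elliptic curves `E₀, E₁` (induced from `k₀, k₁`), `2, …, 7` the threefolds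
`T₀, …, T₅` (induced from the six sextic CM subfields `F^{⟨s rⁱ⟩}`), `8, 9` the two primitive types (sixfolds `B₀, B₁`). [folklore] -/
def blockType : Fin 10 → Finset G :=
  ![{r 0, r 2, r 4, sr 0, sr 2, sr 4},
    {r 0, r 2, r 4, sr 1, sr 3, sr 5},
    {r 0, r 1, r 2, sr 0, sr 4, sr 5},
    {r 0, r 1, r 2, sr 0, sr 1, sr 5},
    {r 0, r 1, r 5, sr 0, sr 1, sr 5},
    {r 0, r 1, r 5, sr 0, sr 1, sr 2},
    {r 0, r 4, r 5, sr 0, sr 1, sr 2},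
    {r 0, r 1, r 2, sr 3, sr 4, sr 5},
    {r 0, r 1, r 2, sr 0, sr 2, sr 4},
    {r 0, r 1, r 5, sr 0, sr 2, sr 4}]

/-- The right stabilisers of the block types: `⟨r², s⟩`, `⟨r², sr⟩` (the two `S₃`), the six reflection groups `⟨s rⁱ⟩`, trivial. [folklore] -/
def stab : Fin 10 → Finset G :=
  ![{r 0, r 2, r 4, sr 0, sr 2, sr 4},
    {r 0, r 2, r 4, sr 1, sr 3, sr 5},
    {r 0, sr 0},
    {r 0, sr 1},
    {r 0, sr 0},
    {r 0, sr 1},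
    {r 0, sr 0},
    {r 0, sr 5},
    {r 0},
    {r 0}]

set_option maxRecDepth 20000 in
/-- **Types census.**  `(G, c)` has exactly `64` CM types, exactly the right translates `T·g` of the ten block types; right stabilisers
`stab`; orbit sizes `2, 2, 6, 6, 6, 6, 6, 6, 12, 12` (sum `64`: the ten simple factors are pairwise non-isogenous and exhaust the simple CM
abelian varieties split by `F`; dimensions `12/(2·|stab|) = 1, 1, 3, …, 3, 6, 6`). [folklore] -/
theorem types_census : cmTypes.card = 64 ∧
    cmTypes = (univ ×ˢ (univ : Finset (Fin 10))).image (fun p => (blockType p.2).image (fun t => t * p.1)) ∧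
    (∀ b : Fin 10, (univ.filter fun g : G => (blockType b).image (fun t => t * g) = blockType b) = stab b) ∧
    (∀ b : Fin 10, (univ.image fun g : G => (blockType b).image (fun t => t * g)).card = (![2, 2, 6, 6, 6, 6, 6, 6, 12, 12] : Fin 10 → ℕ) b) := by
  refine ⟨by decide +kernel, by decide +kernel, by decide +kernel, by decide +kernel⟩

/-! ## Labels, the Galois action, the total type -/

/-- Labels of the CM eigenvectors: `e j u` (`u ∈ ℤ/2`: the curve `E_j`), `t j u` (`u ∈ ℤ/6`: the coset `r^u·stab` of the threefold `T_j`),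
`q j g` (`g ∈ G`: the sixfold `B_j`); `64 = 2·2 + 6·6 + 2·12`. [folklore] -/
abbrev Pt := (Fin 2 × ZMod 2) ⊕ ((Fin 6 × ZMod 6) ⊕ (Fin 2 × G))

/-- `e j u`: eigen-label `u` of the elliptic curve `E_j`. [folklore] -/
abbrev e (j : Fin 2) (u : ZMod 2) : Pt := Sum.inl (j, u)

/-- `t j u`: eigen-label `u` of the threefold `T_j` (the left coset `r^u ⟨s r^{κ_j}⟩`). [folklore] -/
abbrev t (j : Fin 6) (u : ZMod 6) : Pt := Sum.inr (Sum.inl (j, u))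

/-- `q j g`: eigen-label `g` of the sixfold `B_j`. [folklore] -/
abbrev q (j : Fin 2) (g : G) : Pt := Sum.inr (Sum.inr (j, g))

/-- `DecidableEq` of the label type, synthesised once. [folklore] -/
instance instDecidableEqPt : DecidableEq Pt := inferInstance

/-- `Fintype` of the label type, synthesised once. [folklore] -/
instance instFintypePt : Fintype Pt := inferInstance

/-- The block of a label (`0,1` = `E₀,E₁`; `2,…,7` = `T₀,…,T₅`; `8,9` = `B₀,B₁`). [folklore] -/
def blockOf : Pt → Fin 10
  | Sum.inl (j, _) => ⟨j.val, by omega⟩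
  | Sum.inr (Sum.inl (j, _)) => ⟨j.val + 2, by omega⟩
  | Sum.inr (Sum.inr (j, _)) => ⟨j.val + 8, by omega⟩

/-- The quotient maps `G → G/Gal(F/k_j) ≅ ℤ/2`: `r i ↦ i`, `s rⁱ ↦ i + π_j`, `π = (0, 1)`. [folklore] -/
def epsE (j : Fin 2) : G → ZMod 2
  | r i => if i.val % 2 = 0 then 0 else 1
  | sr i => if (i.val + (![0, 1] : Fin 2 → ℕ) j) % 2 = 0 then 0 else 1

/-- The reflection index `κ_j` of the stabiliser `⟨s r^{κ_j}⟩` of the threefold type `j`. [folklore] -/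
def kT : Fin 6 → ZMod 6 := ![0, 1, 0, 1, 0, 5]

/-- The coset map `G → G/⟨s r^{κ_j}⟩ ≅ ℤ/6` (label of the coset containing `g`): `r i ↦ i`, `s rⁱ ↦ κ_j − i`. [folklore] -/
def labT (j : Fin 6) : G → ZMod 6
  | r i => i
  | sr i => kT j - i

/-- `G` acts on the labels: through `epsE j` on the curves, AFFINELY on the threefold cosets (`r^i : u ↦ u + i`,
`s r^i : u ↦ κ_j − i − u`), by left multiplication on the sixfold labels (Galois conjugation of eigenvectors). [folklore] -/
def act (g : G) (x : Pt) : Pt :=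
  match g, x with
  | g, Sum.inl (j, u) => Sum.inl (j, epsE j g + u)
  | r i, Sum.inr (Sum.inl (j, u)) => Sum.inr (Sum.inl (j, u + i))
  | sr i, Sum.inr (Sum.inl (j, u)) => Sum.inr (Sum.inl (j, kT j - i - u))
  | g, Sum.inr (Sum.inr (j, h)) => Sum.inr (Sum.inr (j, g * h))

/-- The total CM type `Φ` (labels of Hodge type `(1,0)`), block by block (`labels_census`). [folklore] -/
def phi : Finset Pt := {e 0 0, e 1 0, t 0 0, t 0 1, t 0 2, t 1 0, t 1 1, t 1 2, t 2 0, t 2 1, t 2 5, t 3 0, t 3 1, t 3 5,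
  t 4 0, t 4 4, t 4 5, t 5 0, t 5 1, t 5 2, q 0 (r 0), q 0 (r 1), q 0 (r 2), q 0 (sr 0), q 0 (sr 2), q 0 (sr 4),
  q 1 (r 0), q 1 (r 1), q 1 (r 5), q 1 (sr 0), q 1 (sr 2), q 1 (sr 4)}

set_option maxRecDepth 20000 in
/-- `Φ` is a CM type for `c = r³`, and `act` is a left action (closed sanity check). [folklore] -/
theorem sanity : (∀ x : Pt, x ∈ phi ↔ act (r 3) x ∉ phi) ∧ (∀ g h : G, ∀ x : Pt, act (g * h) x = act g (act h x)) ∧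
    (∀ x : Pt, act 1 x = x) := by
  refine ⟨by decide +kernel, by decide +kernel, by decide +kernel⟩

set_option maxRecDepth 20000 in
/-- **Labels census**: `epsE j` is a homomorphism with kernel `stab j`; `labT j` is `G`-equivariant for `act` with fibre `stab (j+2)` over `0`
(so the threefold labels ARE the coset sets `G/⟨s r^{κ_j}⟩` with the left action); `Φ` is induced by the block types. [folklore] -/
theorem labels_census : (∀ j : Fin 2, ∀ g h : G, epsE j (g * h) = epsE j g + epsE j h) ∧
    (∀ j : Fin 2, (univ.filter fun g : G => epsE j g = 0) = stab (blockOf (e j 0))) ∧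
    (∀ j : Fin 6, ∀ g h : G, t j (labT j (g * h)) = act g (t j (labT j h))) ∧
    (∀ j : Fin 6, (univ.filter fun g : G => labT j g = 0) = stab (blockOf (t j 0))) ∧
    (∀ j : Fin 2, ∀ g : G, e j (epsE j g) ∈ phi ↔ g ∈ blockType (blockOf (e j 0))) ∧
    (∀ j : Fin 6, ∀ g : G, t j (labT j g) ∈ phi ↔ g ∈ blockType (blockOf (t j 0))) ∧
    (∀ j : Fin 2, ∀ g : G, q j g ∈ phi ↔ g ∈ blockType (blockOf (q j 1))) := by
  refine ⟨by decide +kernel, by decide +kernel, by decide +kernel, by decide +kernel, by decide +kernel, by decide +kernel,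
    by decide +kernel⟩

/-! ## Pohlmann's Hodge forms and the Hodge lattice -/

/-- Pohlmann's Hodge functional of `g ∈ G` on integer exponent vectors: `Σ_x (2[g·x ∈ Φ] − 1) m_x`. [cite: Pohlmann1968, Thm 1] -/
def hodgeForm (g : G) (m : Pt → ℤ) : ℤ := ∑ x : Pt, (if act g x ∈ phi then m x else -m x)

/-- `Φ` on the labels `e j u` (Boolean table, kernel-fast). [folklore] -/
def tE : Fin 2 → Fin 2 → Bool := ![![true, false], ![true, false]]

/-- `Φ` on the labels `t j u`. [folklore] -/
def tT : Fin 6 → Fin 6 → Bool :=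
  ![![true, true, true, false, false, false],
    ![true, true, true, false, false, false],
    ![true, true, false, false, false, true],
    ![true, true, false, false, false, true],
    ![true, false, false, false, true, true],
    ![true, true, true, false, false, false]]

/-- `Φ` on the labels `q j (r i)`. [folklore] -/
def tBr : Fin 2 → Fin 6 → Bool := ![![true, true, true, false, false, false], ![true, true, false, false, false, true]]

/-- `Φ` on the labels `q j (sr i)`. [folklore] -/
def tBs : Fin 2 → Fin 6 → Bool := ![![true, false, true, false, true, false], ![true, false, true, false, true, false]]

/-- Boolean membership in `Φ` (kernel-fast twin of `· ∈ phi`, see `inPhi_iff`). [folklore] -/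
def inPhi : Pt → Bool
  | Sum.inl (j, u) => tE j u
  | Sum.inr (Sum.inl (j, u)) => tT j u
  | Sum.inr (Sum.inr (j, r i)) => tBr j i
  | Sum.inr (Sum.inr (j, sr i)) => tBs j i

/-- `inPhi` decides membership in `Φ`. [folklore] -/
theorem inPhi_iff : ∀ x : Pt, inPhi x = true ↔ x ∈ phi := by decide

/-- The coefficient vector `(2[g·x ∈ Φ] − 1)_x ∈ {±1}^{64}` of Pohlmann's form `hodgeForm g`. [cite: Pohlmann1968, Thm 1] -/
def hodgeVec (g : G) (x : Pt) : ℤ := if inPhi (act g x) then 1 else -1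

/-- `hodgeVec` in terms of `Φ`. [folklore] -/
theorem hodgeVec_apply (g : G) (x : Pt) : hodgeVec g x = if act g x ∈ phi then 1 else -1 := by
  unfold hodgeVec
  by_cases h : act g x ∈ phi
  · simp [h, (inPhi_iff (act g x)).mpr h]
  · have h' : inPhi (act g x) ≠ true := fun h'' => h ((inPhi_iff _).mp h'')
    simp [h, h']

/-- Pohlmann's form is the dot product with its coefficient vector. [folklore] -/
theorem hodgeForm_eq (g : G) (m : Pt → ℤ) : hodgeForm g m = hodgeVec g ⬝ᵥ m := by
  unfold hodgeForm dotProduct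
  refine Finset.sum_congr rfl fun x _ => ?_
  rw [hodgeVec_apply]
  by_cases hx : act g x ∈ phi <;> simp [hx]

/-- **The Hodge lattice** `H ⊂ ℤ^{64}` of the whole `F`-slice (rank `58` by the oracle). [cite: Pohlmann1968, Thm 1] -/
def hodgeLattice : Submodule ℤ (Pt → ℤ) where
  carrier := {m | ∀ g : G, hodgeVec g ⬝ᵥ m = 0}
  zero_mem' := by intro g; simp
  add_mem' := by
    intro m m' hm hm' g
    rw [dotProduct_add, hm g, hm' g, add_zero]
  smul_mem' := by
    intro c m hm g
    rw [dotProduct_smul, hm g, smul_zero]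

/-- Membership in the Hodge lattice = vanishing of all Pohlmann forms. [folklore] -/
theorem mem_hodgeLattice (m : Pt → ℤ) : m ∈ hodgeLattice ↔ ∀ g : G, hodgeForm g m = 0 := by
  simp only [hodgeForm_eq]; rfl

/-- The conjugate pair through a label (a divisor-class monomial `e_x ∧ e_{cx}`). [folklore] -/
def pairVec (x : Pt) (y : Pt) : ℤ := if y = x ∨ y = act (r 3) x then 1 else 0

/-- The divisor sublattice `P = ℤ⟨32 conjugate pairs⟩`. [folklore] -/
def pairs : Submodule ℤ (Pt → ℤ) := Submodule.span ℤ (Set.range pairVec)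

/-- Galois translate of an exponent vector: `(g·v)(y) = v(g⁻¹·y)`. [folklore] -/
def transl (g : G) (v : Pt → ℤ) (y : Pt) : ℤ := v (act g⁻¹ y)

/-- The SIX WEIL ORBITS of dimension `≤ 5`: the Weil planes of the CM fourfolds `E₁ × T₅`, `E₁ × T₃`, `E₁ × T₁`, `E₀ × T₄`, `E₀ × T₂`,
`E₀ × T₀` (Künneth `(1,3)`, orbits of size `2`); with the pairs they span every Hodge monomial on a carrier of dimension `≤ 5` (oracle). [folklore] -/
def mkRep : Fin 6 → Finset Pt :=
  ![{e 1 1, t 5 0, t 5 2, t 5 4},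
    {e 1 1, t 3 1, t 3 3, t 3 5},
    {e 1 1, t 1 0, t 1 2, t 1 4},
    {e 0 1, t 4 0, t 4 2, t 4 4},
    {e 0 1, t 2 1, t 2 3, t 2 5},
    {e 0 1, t 0 0, t 0 2, t 0 4}]

/-- The Weil-orbit monomials as exponent vectors. [folklore] -/
def mkVec (k : Fin 6) (y : Pt) : ℤ := if y ∈ mkRep k then 1 else 0

/-- The "Markman" sublattice `Mk` = translates of the six Weil orbits (classes on CM abelian fourfolds of Weil type). [folklore] -/
def markman : Submodule ℤ (Pt → ℤ) := Submodule.span ℤ (Set.range fun p : G × Fin 6 => transl p.1 (mkVec p.2))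

/-- Representatives of the FOUR atom orbits (ORDER12-CARRIERS §5, first certified minimal family, profile `(12,12,12,12)`): `R₀` on
`T₄ × T₅ × B₁` (Künneth `(1,2,1)`), `R₁` on `T₄ × T₅ × B₀` (`(2,1,1)`), `R₂` on `T₂ × T₃ × B₁` (`(1,2,1)`), `R₃` on `T₀ × T₁ × B₁`
(`(1,2,1)`); codimension `2`; orbits of `12`. [folklore] -/
def orbitRep : Fin 4 → Finset Pt :=
  ![{t 4 5, t 5 3, t 5 5, q 1 (sr 4)},
    {t 4 3, t 4 5, t 5 4, q 0 (r 2)},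
    {t 2 5, t 3 2, t 3 4, q 1 (r 1)},
    {t 0 5, t 1 2, t 1 4, q 1 (r 0)}]

/-- The atom monomials as exponent vectors. [folklore] -/
def atomVec (k : Fin 4) (y : Pt) : ℤ := if y ∈ orbitRep k then 1 else 0

/-- The atom sublattice `A = Σ_{k<4} ℤ[G]·atom_k`. [folklore] -/
def atoms : Submodule ℤ (Pt → ℤ) := Submodule.span ℤ (Set.range fun p : G × Fin 4 => transl p.1 (atomVec p.2))

/-- **Census of the Weil orbits and the atoms**: Künneth types over the ten blocks and orbit sizes. [folklore] -/
theorem atom_census :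
    (∀ k : Fin 6, (fun j : Fin 10 => ((mkRep k).filter fun x => blockOf x = j).card) = (![![0, 1, 0, 0, 0, 0, 0, 3, 0, 0], ![0, 1, 0, 0, 0, 3, 0, 0, 0, 0], ![0, 1, 0, 3, 0, 0, 0, 0, 0, 0], ![1, 0, 0, 0, 0, 0, 3, 0, 0, 0], ![1, 0, 0, 0, 3, 0, 0, 0, 0, 0], ![1, 0, 3, 0, 0, 0, 0, 0, 0, 0]] : Fin 6 → Fin 10 → ℕ) k) ∧
    (∀ k : Fin 6, (univ.image fun g : G => (mkRep k).image (act g)).card = 2) ∧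
    (∀ k : Fin 4, (fun j : Fin 10 => ((orbitRep k).filter fun x => blockOf x = j).card) = (![![0, 0, 0, 0, 0, 0, 1, 2, 0, 1], ![0, 0, 0, 0, 0, 0, 2, 1, 1, 0], ![0, 0, 0, 0, 1, 2, 0, 0, 0, 1], ![0, 0, 1, 2, 0, 0, 0, 0, 0, 1]] : Fin 4 → Fin 10 → ℕ) k) ∧
    (∀ k : Fin 4, (univ.image fun g : G => (orbitRep k).image (act g)).card = 12) := by
  refine ⟨by decide, by decide, by decide, by decide⟩

set_option maxRecDepth 20000 in
/-- Every conjugate pair is a Hodge vector. [folklore] -/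
theorem pairVec_hodge : ∀ x : Pt, ∀ g : G, hodgeVec g ⬝ᵥ pairVec x = 0 := by
  decide +kernel

set_option maxRecDepth 20000 in
/-- Every translate of a Weil-orbit monomial is a Hodge vector. [folklore] -/
theorem mk_hodge : ∀ h g : G, ∀ k : Fin 6, hodgeVec g ⬝ᵥ transl h (mkVec k) = 0 := by
  decide +kernel

set_option maxRecDepth 20000 in
/-- Every translate of every atom is a Hodge vector. [folklore] -/
theorem atom_hodge : ∀ h g : G, ∀ k : Fin 4, hodgeVec g ⬝ᵥ transl h (atomVec k) = 0 := by
  decide +kernel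

/-- `P ≤ H`. [folklore] -/
theorem pairs_le : pairs ≤ (hodgeLattice : Submodule ℤ (Pt → ℤ)) :=
  Submodule.span_le.mpr (by rintro _ ⟨x, rfl⟩ g; exact pairVec_hodge x g)

/-- `Mk ≤ H`. [folklore] -/
theorem markman_le : markman ≤ (hodgeLattice : Submodule ℤ (Pt → ℤ)) :=
  Submodule.span_le.mpr (by rintro _ ⟨p, rfl⟩ g; exact mk_hodge p.1 g p.2)

/-- `A ≤ H`. [folklore] -/
theorem atoms_le : atoms ≤ (hodgeLattice : Submodule ℤ (Pt → ℤ)) :=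
  Submodule.span_le.mpr (by rintro _ ⟨p, rfl⟩ g; exact atom_hodge p.1 g p.2)

/-- Translates of atoms are in `A`. [folklore] -/
theorem transl_atomVec_mem (g : G) (k : Fin 4) : transl g (atomVec k) ∈ atoms := Submodule.subset_span ⟨(g, k), rfl⟩

end Summit.HodgeConjecture.CorCM.Census.DodecicDihedralSpecies
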